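import Literature.NumberTheory.EllipticCurves.DivisionFieldReducibleBorelKernel
import HarnessLib

/-!
# `[K(χ₁, χ₂) : K] ∣ (p − 1)²`: the Borel field of a stable line of a reducible `E[p]` has degree dividing `(p−1)²`
# (the two characters `χ₁, χ₂ : Γ_K → 𝔽_p^×`; theorems only, no definition, no named fact)

Topic `NumberTheory/EllipticCurves` (namespace `WeierstrassCurve`, sibling of `DivisionFieldReducibleBorelKernel.lean`).  Written by
the prover seat `bsd-potss-rkm` g36 (cell `bsd-potss`, item stmt-BirchSwinnertonDyer-19196 `ReducibleKatoMember`; `--supports`, closes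
nothing).

WHY.  For a `Γ_K`-stable line `C` of `E[p]` (`#C = p`, `#E[p] = p²`), `σ ∈ Γ_K` acts on `C` by a scalar `χ₁(σ) ∈ 𝔽_p^×`
(`exists_forall_smul_eq_zsmul_of_card_eq`) and on `E[p]/C` by a scalar `χ₂(σ) ∈ 𝔽_p^×` (`exists_forall_smul_sub_zsmul_mem`); the pair
`(χ₁, χ₂) : Γ_K → (𝔽_p^×)²` is a homomorphism with kernel EXACTLY the Borel kernel `borelKernel C` (Serre 1972 §4: `ρ̄ = (χ₁ *; 0 χ₂)`).
Hence `[K(χ₁,χ₂) : K] = [Γ_K : borelKernel C] = #image ∣ (p−1)²`.  At `p = 3` this is `[ℚ(χ₁,χ₂) : ℚ] ∣ 4`, the input that makes the Borel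
field (bi)quadratic in the reflection road of `IwasawaTheory/ClassicalMuVanishesReflectionDescent.lean`.

* (inside the proof) the homomorphism `Γ_K → (ZMod p)ˣ × (ZMod p)ˣ`, `σ ↦ (χ₁(σ), χ₂(σ))`, with kernel `borelKernel C`.
* `index_borelKernel_dvd` — `[Γ_K : borelKernel C] ∣ (p − 1)²`; `finrank_borelField_dvd` — `[K(χ₁,χ₂) : K] ∣ (p − 1)²` (`char K = 0`).

References: [Serre1972] §4 (the Borel case); [SerreAbelianLadic1968] IV.1.1–1.2; [Wuthrich2014] Lemma 14 (p. 396).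
Design: no definition, no `instance`, no notation.  Axioms: `propext`, `Classical.choice`, `Quot.sound`.
-/

set_option autoImplicit false

noncomputable section

open scoped Classical
open Field IntermediateField Literature.NumberTheory.EllipticCurves Literature.NumberTheory.GaloisRepresentations

universe u

namespace WeierstrassCurve

variable {K : Type u} [Field K] (W : WeierstrassCurve K) {p : ℕ}

section Scalars

variable {W} [hp : Fact p.Prime] {C : AddSubgroup (W.geomTorsion (p : ℤ))}

omit hp in
/-- `p • x = 0` on `E[p]`. [folklore] -/
private theorem p_zsmul_eq_zero (x : W.geomTorsion (p : ℤ)) : (p : ℤ) • x = 0 := by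
  apply Subtype.ext
  have hx : ((x : W.geomTorsion (p : ℤ)) : geomPoints W) ∈ AddSubgroup.torsionBy (geomPoints W) (p : ℤ) := x.2
  rw [AddSubgroup.torsionBy, Submodule.mem_toAddSubgroup, Submodule.mem_torsionBy_iff] at hx
  rw [AddSubgroupClass.coe_zsmul, ZeroMemClass.coe_zero]
  exact hx

omit hp in
/-- Congruent scalars act alike on `E[p]`. [folklore] -/
private theorem zsmul_eq_zsmul_of_dvd_sub {k k' : ℤ} (h : (p : ℤ) ∣ k - k') (x : W.geomTorsion (p : ℤ)) :
    k • x = k' • x := by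
  obtain ⟨m, hm⟩ := h
  have : k = k' + p * m := by omega
  rw [this, add_smul, mul_comm, mul_smul, p_zsmul_eq_zero, smul_zero, add_zero]

/-- A scalar killing a non-zero element of `E[p]` is divisible by `p`. [folklore] -/
private theorem dvd_of_zsmul_eq_zero {g : W.geomTorsion (p : ℤ)} (hg0 : g ≠ 0) {k : ℤ} (hk : k • g = 0) :
    (p : ℤ) ∣ k := by
  have hord : addOrderOf g = p := by
    have hpg : p • g = 0 := by rw [← natCast_zsmul]; exact p_zsmul_eq_zero g
    exact addOrderOf_eq_prime hpg hg0
  rw [← hord]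
  exact (addOrderOf_dvd_iff_zsmul_eq_zero).mpr hk

/-- A scalar moving `y₀ ∉ C` into `C` is divisible by `p`. [folklore] -/
private theorem dvd_of_zsmul_mem {y₀ : W.geomTorsion (p : ℤ)} (hy₀ : y₀ ∉ C) {k : ℤ} (hk : k • y₀ ∈ C) :
    (p : ℤ) ∣ k := by
  by_contra hnd
  have hpr : Prime (p : ℤ) := Nat.prime_iff_prime_int.mp hp.out
  obtain ⟨u, v, huv⟩ := (Prime.coprime_iff_not_dvd hpr).mpr hnd
  apply hy₀
  have : y₀ = v • (k • y₀) + u • ((p : ℤ) • y₀) := by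
    rw [smul_smul, smul_smul, ← add_smul, show v * k + u * p = 1 by linear_combination huv, one_smul]
  rw [this, p_zsmul_eq_zero, smul_zero, add_zero]
  exact C.zsmul_mem hk v

omit hp in
/-- No `σ` kills the line `C ≠ 0`: the scalar `χ₁(σ)` is prime to `p`. [folklore] -/
private theorem not_dvd_scalar_line (h1 : C ≠ ⊥) (σ : absoluteGaloisGroup K) {a : ℤ}
    (ha : ∀ x : W.geomTorsion (p : ℤ), x ∈ C → σ • x = a • x) : ¬ (p : ℤ) ∣ a := by
  intro hdvd
  apply h1
  rw [eq_bot_iff]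
  intro c hc
  have hσc : σ • c = 0 := by
    rw [ha c hc, zsmul_eq_zsmul_of_dvd_sub (k' := 0) (by simpa using hdvd), zero_smul]
  have : c = σ⁻¹ • (σ • c) := (inv_smul_smul σ c).symm
  rw [this, hσc, smul_zero]
  exact AddSubgroup.mem_bot.mpr rfl

omit hp in
/-- No `σ` maps `E[p]` into `C ≠ E[p]`: the scalar `χ₂(σ)` is prime to `p`. [folklore] -/
private theorem not_dvd_scalar_quot (h2 : C ≠ ⊤) (σ : absoluteGaloisGroup K) {b : ℤ}
    (hb : ∀ y : W.geomTorsion (p : ℤ), σ • y - b • y ∈ C) : ¬ (p : ℤ) ∣ b := by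
  intro hdvd
  apply h2
  rw [eq_top_iff]
  intro y _
  have hσy : ∀ w : W.geomTorsion (p : ℤ), σ • w ∈ C := fun w => by
    have h := hb w
    rwa [zsmul_eq_zsmul_of_dvd_sub (k' := 0) (by simpa using hdvd), zero_smul, sub_zero] at h
  have : y = σ • (σ⁻¹ • y) := (smul_inv_smul σ y).symm
  rw [this]
  exact hσy _

end Scalars

section Characters

variable {W} [hp : Fact p.Prime] {C : AddSubgroup (W.geomTorsion (p : ℤ))}

/-- **`[Γ_K : borelKernel C] ∣ (p − 1)²`** for a stable line `C` of `E[p]` (`C ≠ 0, E[p]`, `#E[p] = p²`): the Borel kernel is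
the kernel of the character pair `(χ₁, χ₂) : Γ_K → (𝔽_p^×)²` (`χ₁(σ)` the scalar of `σ` on `C`, `χ₂(σ)` the scalar on `E[p]/C`),
whose image has order dividing `#(𝔽_p^×)² = (p−1)²`. [cite: Serre1972, §4 (Borel image: ρ̄ = (χ₁ *; 0 χ₂))]
[cite: SerreAbelianLadic1968, IV.1.1–1.2] -/
theorem index_borelKernel_dvd
    (hC : ∀ (σ : absoluteGaloisGroup K) (x : W.geomTorsion (p : ℤ)), x ∈ C → σ • x ∈ C)
    (h1 : C ≠ ⊥) (h2 : C ≠ ⊤) (hV : Nat.card (W.geomTorsion (p : ℤ)) = p ^ 2) :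
    (W.borelKernel C).index ∣ (p - 1) ^ 2 := by
  have hcard : Nat.card C = p := card_eq_of_ne_bot_of_ne_top hV h1 h2
  -- the scalars `χ₁(σ) = a σ`, `χ₂(σ) = b σ` (choices in `ℤ`)
  choose a ha using fun σ => exists_forall_smul_eq_zsmul_of_card_eq hC hcard σ
  choose b hb using fun σ => exists_forall_smul_sub_zsmul_mem hC hcard hV σ
  -- a non-zero `g ∈ C` and a `y₀ ∉ C`
  obtain ⟨g, hg, hg0⟩ : ∃ g : W.geomTorsion (p : ℤ), g ∈ C ∧ g ≠ 0 := by
    by_contra h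
    push Not at h
    exact h1 (eq_bot_iff.mpr fun c hc => AddSubgroup.mem_bot.mpr (h c hc))
  obtain ⟨y₀, hy₀⟩ : ∃ y₀ : W.geomTorsion (p : ℤ), y₀ ∉ C := by
    by_contra h
    push Not at h
    exact h2 (eq_top_iff.mpr fun y _ => h y)
  have hsz : ∀ (ρ : absoluteGaloisGroup K) (k : ℤ) (x : W.geomTorsion (p : ℤ)), ρ • (k • x) = k • (ρ • x) :=
    fun ρ k x => map_zsmul (DistribSMul.toAddMonoidHom (↥(W.geomTorsion (p : ℤ))) ρ) k x
  -- the scalars are units mod `p`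
  have ha0 : ∀ σ, ((a σ : ℤ) : ZMod p) ≠ 0 := fun σ => by
    rw [Ne, ZMod.intCast_zmod_eq_zero_iff_dvd]; exact not_dvd_scalar_line h1 σ (ha σ)
  have hb0 : ∀ σ, ((b σ : ℤ) : ZMod p) ≠ 0 := fun σ => by
    rw [Ne, ZMod.intCast_zmod_eq_zero_iff_dvd]; exact not_dvd_scalar_quot h2 σ (hb σ)
  -- `a(1) ≡ 1`, `b(1) ≡ 1`
  have ha1 : (p : ℤ) ∣ a 1 - 1 := by
    refine dvd_of_zsmul_eq_zero hg0 ?_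
    rw [sub_smul, one_smul, ← ha 1 g hg, one_smul, sub_self]
  have hb1 : (p : ℤ) ∣ b 1 - 1 := by
    have h := hb 1 y₀
    rw [one_smul] at h
    have h' : (b 1 - 1) • y₀ ∈ C := by
      rw [sub_smul, one_smul]
      have := C.neg_mem h
      rwa [neg_sub] at this
    exact dvd_of_zsmul_mem hy₀ h'
  -- multiplicativity mod `p`
  have hamul : ∀ σ τ, (p : ℤ) ∣ a (σ * τ) - a σ * a τ := fun σ τ => by
    refine dvd_of_zsmul_eq_zero hg0 ?_
    rw [sub_smul, ← ha (σ * τ) g hg, mul_smul σ τ g, ha τ g hg, hsz, ha σ g hg, smul_smul, mul_comm, sub_self]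
  have hbmul : ∀ σ τ, (p : ℤ) ∣ b (σ * τ) - b σ * b τ := fun σ τ => by
    have e1 : σ • (τ • y₀ - b τ • y₀) ∈ C := hC σ _ (hb τ y₀)
    have e2 : b τ • (σ • y₀ - b σ • y₀) ∈ C := C.zsmul_mem (hb σ y₀) (b τ)
    have e3 : (σ * τ) • y₀ - (b σ * b τ) • y₀ ∈ C := by
      have : (σ * τ) • y₀ - (b σ * b τ) • y₀ = σ • (τ • y₀ - b τ • y₀) + b τ • (σ • y₀ - b σ • y₀) := by
        rw [mul_smul, smul_sub, hsz, smul_sub, smul_smul (b τ) (b σ), mul_comm (b τ) (b σ)]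
        abel
      rw [this]
      exact C.add_mem e1 e2
    have e4 := C.sub_mem (hb (σ * τ) y₀) e3
    have e5 : (b σ * b τ - b (σ * τ)) • y₀ ∈ C := by
      have : (b σ * b τ - b (σ * τ)) • y₀ = ((σ * τ) • y₀ - b (σ * τ) • y₀) - ((σ * τ) • y₀ - (b σ * b τ) • y₀) := by
        rw [sub_smul]; abel
      rw [this]
      exact e4
    have h' : b (σ * τ) - b σ * b τ = -(b σ * b τ - b (σ * τ)) := by ring
    rw [h']
    exact (dvd_of_zsmul_mem hy₀ e5).neg_right
  -- `ℤ → ZMod p` turns `p ∣ x - y` into `↑x = ↑y`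
  have hcast : ∀ {x y : ℤ}, (p : ℤ) ∣ x - y → ((x : ℤ) : ZMod p) = ((y : ℤ) : ZMod p) := by
    intro x y h
    rw [ZMod.intCast_eq_intCast_iff, Int.modEq_iff_dvd]
    simpa using h.neg_right
  -- the character pair `(χ₁, χ₂) : Γ_K → (𝔽_p^×)²`
  let χ : absoluteGaloisGroup K →* (ZMod p)ˣ × (ZMod p)ˣ :=
    { toFun := fun σ => (Units.mk0 ((a σ : ℤ) : ZMod p) (ha0 σ), Units.mk0 ((b σ : ℤ) : ZMod p) (hb0 σ))
      map_one' := by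
        refine Prod.ext (Units.ext ?_) (Units.ext ?_)
        · change ((a 1 : ℤ) : ZMod p) = 1
          rw [← Int.cast_one]; exact hcast ha1
        · change ((b 1 : ℤ) : ZMod p) = 1
          rw [← Int.cast_one]; exact hcast hb1
      map_mul' := fun σ τ => by
        refine Prod.ext (Units.ext ?_) (Units.ext ?_)
        · change ((a (σ * τ) : ℤ) : ZMod p) = ((a σ : ℤ) : ZMod p) * ((a τ : ℤ) : ZMod p)
          rw [← Int.cast_mul]; exact hcast (hamul σ τ)
        · change ((b (σ * τ) : ℤ) : ZMod p) = ((b σ : ℤ) : ZMod p) * ((b τ : ℤ) : ZMod p)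
          rw [← Int.cast_mul]; exact hcast (hbmul σ τ) }
  have hχ : ∀ σ, χ σ = (Units.mk0 ((a σ : ℤ) : ZMod p) (ha0 σ), Units.mk0 ((b σ : ℤ) : ZMod p) (hb0 σ)) := fun σ => rfl
  -- its kernel is the Borel kernel
  have hker : χ.ker = W.borelKernel C := by
    ext σ
    rw [MonoidHom.mem_ker, mem_borelKernel_iff, hχ]
    constructor
    · intro h
      have ha' : ((a σ : ℤ) : ZMod p) = ((1 : ℤ) : ZMod p) := by
        have := congrArg (fun u : (ZMod p)ˣ × (ZMod p)ˣ => (u.1 : ZMod p)) h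
        simpa using this
      have hb' : ((b σ : ℤ) : ZMod p) = ((1 : ℤ) : ZMod p) := by
        have := congrArg (fun u : (ZMod p)ˣ × (ZMod p)ˣ => (u.2 : ZMod p)) h
        simpa using this
      rw [ZMod.intCast_eq_intCast_iff, Int.modEq_iff_dvd] at ha' hb'
      refine ⟨fun x hx => ?_, fun y => ?_⟩
      · rw [ha σ x hx, zsmul_eq_zsmul_of_dvd_sub (k' := 1) _ x, one_smul]
        simpa using ha'.neg_right
      · have h3 := hb σ y
        rwa [zsmul_eq_zsmul_of_dvd_sub (k' := 1) _ y, one_smul] at h3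
        simpa using hb'.neg_right
    · rintro ⟨hσC, hσV⟩
      have ha' : (p : ℤ) ∣ a σ - 1 := by
        refine dvd_of_zsmul_eq_zero hg0 ?_
        rw [sub_smul, one_smul, ← ha σ g hg, hσC g hg, sub_self]
      have hb' : (p : ℤ) ∣ b σ - 1 := by
        have e1 := C.sub_mem (hσV y₀) (hb σ y₀)
        have : (b σ - 1) • y₀ = (σ • y₀ - y₀) - (σ • y₀ - b σ • y₀) := by
          rw [sub_smul, one_smul]; abel
        exact dvd_of_zsmul_mem hy₀ (this ▸ e1)
      refine Prod.ext (Units.ext ?_) (Units.ext ?_)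
      · change ((a σ : ℤ) : ZMod p) = 1
        rw [← Int.cast_one]; exact hcast ha'
      · change ((b σ : ℤ) : ZMod p) = 1
        rw [← Int.cast_one]; exact hcast hb'
  -- count
  rw [← hker, Subgroup.index_ker]
  have h := Subgroup.card_subgroup_dvd_card χ.range
  have hu : Nat.card ((ZMod p)ˣ × (ZMod p)ˣ) = (p - 1) ^ 2 := by
    rw [Nat.card_prod, Nat.card_eq_fintype_card, ZMod.card_units_eq_totient, Nat.totient_prime hp.out, sq]
  rwa [hu] at h

/-- **`[K(χ₁, χ₂) : K] ∣ (p − 1)²`** (`char K = 0`, `E` elliptic, `C` a stable line of `E[p]`): the degree of the Borel field.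
At `p = 3`: `[ℚ(χ₁, χ₂) : ℚ] ∣ 4`. [cite: Serre1972, §4 (Borel image)] [cite: Wuthrich2014, Lemma 14 (p. 396)] -/
theorem finrank_borelField_dvd [CharZero K] [W.IsElliptic]
    (hC : ∀ (σ : absoluteGaloisGroup K) (x : W.geomTorsion (p : ℤ)), x ∈ C → σ • x ∈ C)
    (h1 : C ≠ ⊥) (h2 : C ≠ ⊤) :
    Module.finrank K (W.borelField C) ∣ (p - 1) ^ 2 := by
  haveI : NeZero p := ⟨hp.out.ne_zero⟩
  have hV : Nat.card (W.geomTorsion (p : ℤ)) = p ^ 2 := W.natCard_geomTorsion_eq_sq_of_charZero hp.out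
  rw [finrank_borelField]
  exact index_borelKernel_dvd hC h1 h2 hV

end Characters

end WeierstrassCurve

end
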